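/-
COR-CM (cell pub-hodgecm2) — ¬hJ RUSH, HEAD-B (κ-line ∕ EDITION B), leaf 1∕3: the LIFT.  Pen prover-pub-hodgecm2-hmusep-p5-g3-0 (hmusep-p5 g3),
2026-08-24.  For a record `J'` at the conjugate instance `ῑ₁` with injective rational pull-backs (R1-inj) and a record `J₁` at `ι₁` over the SAME
App.-C datum, the `ℂ`-linear map `E : N_ℂ → H` on `N_ℂ := ⨆_K range (ιT ∘ (ofQ Γ'_K ∘ J'^*_K) ⊗ ℂ)` with
`E (genC ῑ₁ J' K w) = genC ι₁ J₁ K (κ_K⁻¹ ⊗ ℂ · w)` (`κ` = ✔ wb-1 `bettiConjLinearEquiv`), commuting with every Hecke operator `act g`.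
§1 an abstract lift over a codirected system (Mathlib-level); §2 the generators `genAt` and their laws (iii)(iv) from ✔ `albStarQ_pull_Atr ∕
albStarQ_pull_albTr`, ✔ `ofQ_restrictQ ∕ actQ_ofQ`, ✔ `C5.heckeLevel`, κ-naturality ✔ `bettiConjLinearEquiv_pull_baseChange`; §3 the complex lift.
THEOREMS (+ two `abbrev`s, one `def genC`); no named fact, no `sorry`, no new axiom; nothing landed is edited.  FRAMING: HC_CM is NOT proved;
nothing here asserts hJ, hJ₀ or their negations; `J₁` and R1-inj are HYPOTHESES of the theorems.
-/
import Summits.HodgeConjecture.CorCM.D2Bridge.Map43RecordAtPinLevels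
import Summits.HodgeConjecture.CorCM.D2Bridge.BettiConjugateEmbedding
import HarnessLib

set_option autoImplicit false

/-!
# ¬hJ₀, HEAD-B (κ-line), leaf 1∕3: the lift `E`

For a component-Albanese record `J'` at the conjugate instance `ῑ₁` with injective rational pull-backs and a record `J₁` at `ι₁` over the
same App.-C datum ([Liu2021] §4.2), the `ℂ`-linear map `E` on `N_ℂ := ⨆_K range (ιT ∘ (ofQ Γ'_K ∘ J'^*_K) ⊗ ℂ)` with
`E (genC ῑ₁ J' K w) = genC ι₁ J₁ K (κ_K⁻¹ ⊗ ℂ · w)`, commuting with every Hecke operator.  §1 abstract lift over a codirected system,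
§2 generators and their laws (iii)(iv), §3 the complex lift.  HC_CM is NOT proved; `J₁` and R1-injectivity are hypotheses.
-/

noncomputable section

namespace Summit.HodgeConjecture.CorCM.D2Bridge.NotHJ

open Function

/-! ## §1 The abstract lift (verbatim `DirectedSpanLift.lean`) -/

section DirectedSpanLift

variable {𝒦 : Type*} [Preorder 𝒦]
  {R : Type*} [Semiring R] {A : 𝒦 → Type*} [∀ K, AddCommMonoid (A K)] [∀ K, Module R (A K)]
  {U : Type*} [AddCommMonoid U] [Module R U]
  (tr : ∀ {K' K : 𝒦}, K' ≤ K → (A K →ₗ[R] A K'))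
  (gen gen' : ∀ K, A K →ₗ[R] U)

/-- The span of the first family's images: `N := ⨆ K, range (gen K)`. [folklore] -/
abbrev spanOfLevels : Submodule R U := ⨆ K, LinearMap.range (gen K)

variable {tr gen gen'}

/-- Compatibility with level change makes the images grow as the level shrinks. [folklore] -/
theorem range_le_range_of_le (hgen : ∀ {K' K : 𝒦} (h : K' ≤ K) (x : A K), gen K' (tr h x) = gen K x)
    {K' K : 𝒦} (h : K' ≤ K) : LinearMap.range (gen K) ≤ LinearMap.range (gen K') := by
  rintro _ ⟨x, rfl⟩
  exact ⟨tr h x, hgen h x⟩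

/-- Under codirectedness every element of the span lies in ONE image `range (gen K)`. [folklore] -/
theorem exists_mem_range_of_mem_span [Nonempty 𝒦] (hdir : ∀ K K' : 𝒦, ∃ K₀, K₀ ≤ K ∧ K₀ ≤ K')
    (hgen : ∀ {K' K : 𝒦} (h : K' ≤ K) (x : A K), gen K' (tr h x) = gen K x)
    {n : U} (hn : n ∈ spanOfLevels gen) : ∃ K x, gen K x = n := by
  have hd : Directed (· ≤ ·) fun K => LinearMap.range (gen K) := by
    intro K K'
    obtain ⟨K₀, h₀, h₀'⟩ := hdir K K'
    exact ⟨K₀, range_le_range_of_le hgen h₀, range_le_range_of_le hgen h₀'⟩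
  obtain ⟨K, x, rfl⟩ := (Submodule.mem_iSup_of_directed _ hd).1 hn
  exact ⟨K, x, rfl⟩

/-- Independence of the representative (level-wise injectivity of `gen`). [folklore] -/
theorem gen'_eq_of_gen_eq (hdir : ∀ K K' : 𝒦, ∃ K₀, K₀ ≤ K ∧ K₀ ≤ K')
    (hgen : ∀ {K' K : 𝒦} (h : K' ≤ K) (x : A K), gen K' (tr h x) = gen K x)
    (hgen' : ∀ {K' K : 𝒦} (h : K' ≤ K) (x : A K), gen' K' (tr h x) = gen' K x)
    (hinj : ∀ K, Injective (gen K))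
    {K K' : 𝒦} {x : A K} {x' : A K'} (h : gen K x = gen K' x') : gen' K x = gen' K' x' := by
  obtain ⟨K₀, h₀, h₀'⟩ := hdir K K'
  have hx : tr h₀ x = tr h₀' x' := hinj K₀ (by rw [hgen h₀ x, hgen h₀' x', h])
  rw [← hgen' h₀ x, ← hgen' h₀' x', hx]

/-- **THE LIFT.** [folklore] -/
theorem exists_lift_of_injective [Nonempty 𝒦] (hdir : ∀ K K' : 𝒦, ∃ K₀, K₀ ≤ K ∧ K₀ ≤ K')
    (hgen : ∀ {K' K : 𝒦} (h : K' ≤ K) (x : A K), gen K' (tr h x) = gen K x)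
    (hgen' : ∀ {K' K : 𝒦} (h : K' ≤ K) (x : A K), gen' K' (tr h x) = gen' K x)
    (hinj : ∀ K, Injective (gen K)) :
    ∃ E : spanOfLevels gen →ₗ[R] U, ∀ (K : 𝒦) (x : A K) (hx : gen K x ∈ spanOfLevels gen), E ⟨gen K x, hx⟩ = gen' K x := by
  classical
  have hrep : ∀ n : spanOfLevels gen, ∃ p : Σ K, A K, gen p.1 p.2 = (n : U) := fun n => by
    obtain ⟨K, x, hx⟩ := exists_mem_range_of_mem_span hdir hgen n.2
    exact ⟨⟨K, x⟩, hx⟩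
  choose rep hrep using hrep
  let E₀ : spanOfLevels gen → U := fun n => gen' (rep n).1 (rep n).2
  have hE₀ : ∀ (K : 𝒦) (x : A K) (hx : gen K x ∈ spanOfLevels gen), E₀ ⟨gen K x, hx⟩ = gen' K x := by
    intro K x hx
    exact gen'_eq_of_gen_eq hdir hgen hgen' hinj (hrep ⟨gen K x, hx⟩)
  have hpair : ∀ n m : spanOfLevels gen, ∃ (K₀ : 𝒦) (y z : A K₀),
      gen K₀ y = (n : U) ∧ gen K₀ z = (m : U) := by
    intro n m
    obtain ⟨K₀, h₀, h₀'⟩ := hdir (rep n).1 (rep m).1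
    exact ⟨K₀, tr h₀ (rep n).2, tr h₀' (rep m).2, by rw [hgen, hrep], by rw [hgen, hrep]⟩
  refine ⟨{ toFun := E₀, map_add' := ?_, map_smul' := ?_ }, hE₀⟩
  · intro n m
    obtain ⟨K₀, y, z, hy, hz⟩ := hpair n m
    have hn : E₀ n = gen' K₀ y := by
      have := hE₀ K₀ y (hy ▸ n.2); rw [← this]; congr 1; exact Subtype.ext hy.symm
    have hm : E₀ m = gen' K₀ z := by
      have := hE₀ K₀ z (hz ▸ m.2); rw [← this]; congr 1; exact Subtype.ext hz.symm
    have hnm : E₀ (n + m) = gen' K₀ (y + z) := by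
      have hmem : gen K₀ (y + z) ∈ spanOfLevels gen := by rw [map_add, hy, hz]; exact (n + m).2
      have := hE₀ K₀ (y + z) hmem
      rw [← this]; congr 1; apply Subtype.ext; simp [hy, hz]
    rw [hnm, hn, hm, map_add]
  · intro c n
    obtain ⟨K₀, y, -, hy, -⟩ := hpair n n
    have hn : E₀ n = gen' K₀ y := by
      have := hE₀ K₀ y (hy ▸ n.2); rw [← this]; congr 1; exact Subtype.ext hy.symm
    have hcn : E₀ (c • n) = gen' K₀ (c • y) := by
      have hmem : gen K₀ (c • y) ∈ spanOfLevels gen := by rw [map_smul, hy]; exact (c • n).2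
      have := hE₀ K₀ (c • y) hmem
      rw [← this]; congr 1; apply Subtype.ext; simp [hy]
    rw [hcn, hn, map_smul, RingHom.id_apply]

/-- **Stability and equivariance.** [folklore] -/
theorem lift_equivariant [Nonempty 𝒦] (hdir : ∀ K K' : 𝒦, ∃ K₀, K₀ ≤ K ∧ K₀ ≤ K')
    (hgen : ∀ {K' K : 𝒦} (h : K' ≤ K) (x : A K), gen K' (tr h x) = gen K x)
    (ρ : U →ₗ[R] U) (K₁ : 𝒦 → 𝒦) (trg : ∀ K, A K →ₗ[R] A (K₁ K))
    (hρ : ∀ K x, ρ (gen K x) = gen (K₁ K) (trg K x)) (hρ' : ∀ K x, ρ (gen' K x) = gen' (K₁ K) (trg K x))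
    (E : spanOfLevels gen →ₗ[R] U)
    (hE : ∀ (K : 𝒦) (x : A K) (hx : gen K x ∈ spanOfLevels gen), E ⟨gen K x, hx⟩ = gen' K x) :
    (∀ n : U, n ∈ spanOfLevels gen → ρ n ∈ spanOfLevels gen) ∧
      ∀ (n : spanOfLevels gen) (hρn : ρ n ∈ spanOfLevels gen), E ⟨ρ n, hρn⟩ = ρ (E n) := by
  have hstab : ∀ n : U, n ∈ spanOfLevels gen → ρ n ∈ spanOfLevels gen := by
    intro n hn
    obtain ⟨K, x, rfl⟩ := exists_mem_range_of_mem_span hdir hgen hn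
    rw [hρ]
    exact Submodule.mem_iSup_of_mem (K₁ K) ⟨trg K x, rfl⟩
  refine ⟨hstab, fun n hρn => ?_⟩
  obtain ⟨K, x, hx⟩ := exists_mem_range_of_mem_span hdir hgen n.2
  have hmemx : gen K x ∈ spanOfLevels gen := hx ▸ n.2
  have hn : n = ⟨gen K x, hmemx⟩ := Subtype.ext hx.symm
  have hρx : ρ (gen K x) ∈ spanOfLevels gen := by rw [hx]; exact hρn
  have h0 : (⟨ρ (n : U), hρn⟩ : spanOfLevels gen) = ⟨ρ (gen K x), hρx⟩ := Subtype.ext (by simp only [hx])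
  rw [h0, hn]
  have hmem : gen (K₁ K) (trg K x) ∈ spanOfLevels gen := Submodule.mem_iSup_of_mem (K₁ K) ⟨trg K x, rfl⟩
  have h1 : (⟨ρ (gen K x), hρx⟩ : spanOfLevels gen) = ⟨gen (K₁ K) (trg K x), hmem⟩ := Subtype.ext (hρ K x)
  rw [h1, hE, hE, hρ']

end DirectedSpanLift

section Instance

open scoped TensorProduct
open CategoryTheory NumberField
open Literature.AlgebraicGeometry.Motives (AbelianVariety bettiCohomology baseChangeHom)
open Literature.AlgebraicGeometry.Motives.AbelianVariety (Hom.baseChange)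
open Literature.AlgebraicGeometry.HodgeTheory
open Literature.AlgebraicGeometry.HodgeTheory.BettiUniverse (pull)
open Literature.AlgebraicGeometry.ShimuraVarieties.UnitaryCanonicalModel (exists_recordSystem)
open Literature.NumberTheory.Automorphic Literature.NumberTheory.Automorphic.Liu2021 Literature.NumberTheory.Automorphic.Liu2021.AppendixC
open Literature.NumberTheory.Automorphic.PicardCM
open Literature.NumberTheory.Transcendental (Arapura2012_Cor_15_4_6)
open HodgeCM.Model.TowerLevel HodgeCM.Model.TowerCarrier
open Summit.HodgeConjecture.CorCM.D2Bridge.TowerRational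

variable {hHD : exists_isReal_hodgeModel} {hI : hodgePQ_independent_of_hodgeModel}
  {hU : BallQuotientUniformisedDatum} {h₃ : CMAbelianVarietyRealised} {hA : Arapura2012_Cor_15_4_6}
variable {L : HodgeCM.CMField} {ι₁ : L →+* ℂ} {V : HodgeCM.HermSpace3 L ι₁} {h : exists_recordSystem}
  {Φ : Literature.AlgebraicGeometry.Motives.CMType L} {isotropicAt : ℕ → Prop}
  {C : Sec42Data (Model.honestP5Of h ⟨L.K⟩ ι₁ ⟨V.Hm, V.isHermitian, V.signature_ι₁, V.posDef_of_ne⟩ Φ) isotropicAt}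
  {HT : C.HeckeTranslates}

/-- **Codirectedness of the sufficiently small levels**: two levels `K, K' ⊆ K₀` contain the level `K ∩ K'` (open: two opens; compact:
closed — an open subgroup is closed — inside the compact `K`). [cite: Liu2021, Prop. C.5 l. 4627–4628] -/
theorem exists_smallLevel_le_le {H : Type} [Group H] [TopologicalSpace H] [IsTopologicalGroup H] {K₀ : C5.OpenCompactSubgroup H}
    (K K' : C5.SmallLevel K₀) : ∃ K'' : C5.SmallLevel K₀, K'' ≤ K ∧ K'' ≤ K' := by
  refine ⟨⟨⟨K.1.1 ⊓ K'.1.1, ?_, ?_⟩, le_trans (inf_le_left : K.1.1 ⊓ K'.1.1 ≤ K.1.1) K.2⟩,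
    (inf_le_left : K.1.1 ⊓ K'.1.1 ≤ K.1.1), (inf_le_right : K.1.1 ⊓ K'.1.1 ≤ K'.1.1)⟩
  · rw [Subgroup.coe_inf]; exact K.1.2.1.inter K'.1.2.1
  · rw [Subgroup.coe_inf]; exact K.1.2.2.inter_right (Subgroup.isClosed_of_isOpen _ K'.1.2.1)

/-- **The generator of a record at the instance `ι`**: `gen_ι J K := ofQ Γ_K ∘ J^*_K : H¹((A_K ⊗_ι ℂ)(ℂ); ℚ) → TowerQ`.
[cite: Liu2021, §4.2 (FJcycle.tex l. 2062–2074)] -/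
def genAt (ι : L →+* ℂ) (J : letI := ι.toAlgebra; ComponentAlbanese hHD hI hU h₃ hA V h Φ C HT) (K : C5.SmallLevel C.S.K₀) :
    bettiCohomology ((baseChangeHom ι).obj (C.A K).X) 1 →ₗ[ℚ] TowerQ hHD hI hU h₃ hA V :=
  letI := ι.toAlgebra
  ofQ hHD hI hU h₃ hA (J.Γof K) (J.belowConjThree K) ∘ₗ J.albStarQ K

/-- LAW (iii) for the generator: `gen K' ((Alb u)_ℂ^* x) = gen K x` (✔ `albStarQ_pull_Atr` + ✔ `ofQ_restrictQ`).
[cite: Liu2021, §4.2 (FJcycle.tex l. 2070–2072)] -/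
theorem genAt_pull_Atr (ι : L →+* ℂ) (J : letI := ι.toAlgebra; ComponentAlbanese hHD hI hU h₃ hA V h Φ C HT)
    {K K' : C5.SmallLevel C.S.K₀} (f : K' ⟶ K) (x : bettiCohomology ((baseChangeHom ι).obj (C.A K).X) 1) :
    genAt ι J K' (letI := ι.toAlgebra; pull (Hom.baseChange ℂ (C.Atr f)).hom.hom.hom 1 x) = genAt ι J K x := by
  letI := ι.toAlgebra
  show ofQ hHD hI hU h₃ hA _ _ (J.albStarQ K' (pull (Hom.baseChange ℂ (C.Atr f)).hom.hom.hom 1 x)) =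
    ofQ hHD hI hU h₃ hA _ _ (J.albStarQ K x)
  rw [J.albStarQ_pull_Atr f x, ofQ_restrictQ]

/-- LAW (iv) for the generator: `actQ g (gen K x) = gen (gKg⁻¹ ∩ K₀) ((Alb T_g)_ℂ^* x)` (✔ `albStarQ_pull_albTr` + ✔ `ofQ_restrictQ`
+ ✔ `actQ_ofQ`, at the conjugate level ✔ `C5.heckeLevel`). [cite: Liu2021, §4.2 (FJcycle.tex l. 2074)] -/
theorem actQ_genAt (ι : L →+* ℂ) (J : letI := ι.toAlgebra; ComponentAlbanese hHD hI hU h₃ hA V h Φ C HT)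
    (g : ↥V.adelicFin) (K : C5.SmallLevel C.S.K₀) (x : bettiCohomology ((baseChangeHom ι).obj (C.A K).X) 1) :
    actQ hHD hI hU h₃ hA V g (genAt ι J K x) =
      genAt ι J (C5.heckeLevel g K)
        (letI := ι.toAlgebra; pull (Hom.baseChange ℂ (HT.albTr g (C5.heckeLevel g K) K (C5.heckeLE_heckeLevel g K))).hom.hom.hom 1 x) := by
  letI := ι.toAlgebra
  show actQ hHD hI hU h₃ hA V g (ofQ hHD hI hU h₃ hA _ _ (J.albStarQ K x)) =
    ofQ hHD hI hU h₃ hA _ _ (J.albStarQ _ (pull (Hom.baseChange ℂ (HT.albTr g _ K _)).hom.hom.hom 1 x))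
  rw [J.albStarQ_pull_albTr, ofQ_restrictQ, actQ_ofQ]

/-- κ-naturality in the `symm` direction: `κ_A⁻¹ ((φ_ῑ)^* y) = (φ_ι)^* (κ_B⁻¹ y)` (from ✔ `bettiConjLinearEquiv_pull_baseChange`). [folklore] -/
theorem bettiConjLinearEquiv_symm_pull_baseChange (ι : L →+* ℂ) {A B : AbelianVariety L} (φ : A ⟶ B) (k : ℕ)
    (y : letI := (conjEmb ι).toAlgebra; bettiCohomology (B.baseChange ℂ).X k) :
    (bettiConjLinearEquiv ι A.X k).symm
        ((letI := (conjEmb ι).toAlgebra; pull (Hom.baseChange ℂ φ).hom.hom.hom k) y) =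
      (letI := ι.toAlgebra; pull (Hom.baseChange ℂ φ).hom.hom.hom k) ((bettiConjLinearEquiv ι B.X k).symm y) := by
  apply (bettiConjLinearEquiv ι A.X k).injective
  rw [LinearEquiv.apply_symm_apply, bettiConjLinearEquiv_pull_baseChange, LinearEquiv.apply_symm_apply]

end Instance

section Complex

open scoped TensorProduct
open CategoryTheory NumberField
open Literature.AlgebraicGeometry.Motives (AbelianVariety bettiCohomology baseChangeHom)
open Literature.AlgebraicGeometry.Motives.AbelianVariety (Hom.baseChange)
open Literature.AlgebraicGeometry.HodgeTheory
open Literature.AlgebraicGeometry.HodgeTheory.BettiUniverse (pull)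
open Literature.AlgebraicGeometry.ShimuraVarieties.UnitaryCanonicalModel (exists_recordSystem)
open Literature.NumberTheory.Automorphic Literature.NumberTheory.Automorphic.Liu2021 Literature.NumberTheory.Automorphic.Liu2021.AppendixC
open Literature.NumberTheory.Automorphic.PicardCM
open Literature.NumberTheory.Transcendental (Arapura2012_Cor_15_4_6)
open HodgeCM.Model.TowerLevel HodgeCM.Model.TowerCarrier
open Summit.HodgeConjecture.CorCM.D2Bridge.TowerRational

variable {hHD : exists_isReal_hodgeModel} {hI : hodgePQ_independent_of_hodgeModel}
  {hU : BallQuotientUniformisedDatum} {h₃ : CMAbelianVarietyRealised} {hA : Arapura2012_Cor_15_4_6}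
variable {L : HodgeCM.CMField} {ι₁ : L →+* ℂ} {V : HodgeCM.HermSpace3 L ι₁} {h : exists_recordSystem}
  {Φ : Literature.AlgebraicGeometry.Motives.CMType L} {isotropicAt : ℕ → Prop}
  {C : Sec42Data (Model.honestP5Of h ⟨L.K⟩ ι₁ ⟨V.Hm, V.isHermitian, V.signature_ι₁, V.posDef_of_ne⟩ Φ) isotropicAt}
  {HT : C.HeckeTranslates}

/-- `(g ∘ f) ⊗ A = (g ⊗ A) ∘ (f ⊗ A)` on elements (Mathlib `LinearMap.baseChange_comp`), in a form usable by `exact` across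
definitionally equal coefficient types. [folklore] -/
theorem baseChange_comp_apply' {R : Type*} [CommSemiring R] {A : Type*} [CommSemiring A] [Algebra R A]
    {M N P : Type*} [AddCommMonoid M] [AddCommMonoid N] [AddCommMonoid P] [Module R M] [Module R N] [Module R P]
    (g : N →ₗ[R] P) (f : M →ₗ[R] N) (x : TensorProduct R A M) :
    (g ∘ₗ f).baseChange A x = g.baseChange A (f.baseChange A x) := by
  rw [LinearMap.baseChange_comp]
  rfl

/-- The complex coefficient module at an instance `ι`: `ℂ ⊗ H¹((A_K ⊗_ι ℂ)(ℂ); ℚ)`. [folklore] -/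
abbrev ACx (ι : L →+* ℂ) (K : C5.SmallLevel C.S.K₀) : Type :=
  TensorProduct ℚ ℂ (bettiCohomology ((baseChangeHom ι).obj (C.A K).X) 1)

/-- **The complexified generator into the tower**: `genC ι J K := ιT ∘ (ofQ Γ_K ∘ J^*_K) ⊗ ℂ : ℂ ⊗ H¹(A_K ⊗_ι ℂ) → H`.
[cite: Liu2021, §4.2 (FJcycle.tex l. 2062–2074)] -/
def genC (ι : L →+* ℂ) (J : letI := ι.toAlgebra; ComponentAlbanese hHD hI hU h₃ hA V h Φ C HT) (K : C5.SmallLevel C.S.K₀) :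
    ACx ι K →ₗ[ℂ] Tower hHD hI hU h₃ hA V :=
  ιT hHD hI hU h₃ hA V ∘ₗ (genAt ι J K).baseChange ℂ

/-- `genC` unfolded on an element. [folklore] -/
theorem genC_apply (ι : L →+* ℂ) (J : letI := ι.toAlgebra; ComponentAlbanese hHD hI hU h₃ hA V h Φ C HT) (K : C5.SmallLevel C.S.K₀)
    (w : ACx ι K) : genC ι J K w = ιT hHD hI hU h₃ hA V ((genAt ι J K).baseChange ℂ w) := rfl

/-- LAW (iii), complexified: `genC K' ((Alb u)^*_ℂ w) = genC K w`. [cite: Liu2021, §4.2 (FJcycle.tex l. 2070–2072)] -/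
theorem genC_pull_Atr (ι : L →+* ℂ) (J : letI := ι.toAlgebra; ComponentAlbanese hHD hI hU h₃ hA V h Φ C HT)
    {K K' : C5.SmallLevel C.S.K₀} (f : K' ⟶ K) (w : ACx ι K) :
    genC ι J K' ((letI := ι.toAlgebra; pull (Hom.baseChange ℂ (C.Atr f)).hom.hom.hom 1).baseChange ℂ w) = genC ι J K w := by
  have key : genAt ι J K' ∘ₗ (letI := ι.toAlgebra; pull (Hom.baseChange ℂ (C.Atr f)).hom.hom.hom 1) = genAt ι J K :=
    LinearMap.ext fun x => genAt_pull_Atr ι J f x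
  have h2 := (baseChange_comp_apply' (genAt ι J K') _ w).symm.trans (LinearMap.congr_fun (congrArg (LinearMap.baseChange ℂ) key) w)
  exact congrArg (ιT hHD hI hU h₃ hA V) h2

/-- LAW (iv), complexified: `act g (genC K w) = genC (gKg⁻¹ ∩ K₀) ((Alb T_g)^*_ℂ w)`. [cite: Liu2021, §4.2 (FJcycle.tex l. 2074)] -/
theorem act_genC (ι : L →+* ℂ) (J : letI := ι.toAlgebra; ComponentAlbanese hHD hI hU h₃ hA V h Φ C HT)
    (g : ↥V.adelicFin) (K : C5.SmallLevel C.S.K₀) (w : ACx ι K) :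
    act hHD hI hU h₃ hA g (genC ι J K w) =
      genC ι J (C5.heckeLevel g K)
        ((letI := ι.toAlgebra;
          pull (Hom.baseChange ℂ (HT.albTr g (C5.heckeLevel g K) K (C5.heckeLE_heckeLevel g K))).hom.hom.hom 1).baseChange ℂ w) := by
  have key : actQ hHD hI hU h₃ hA V g ∘ₗ genAt ι J K =
      genAt ι J (C5.heckeLevel g K) ∘ₗ
        (letI := ι.toAlgebra; pull (Hom.baseChange ℂ (HT.albTr g (C5.heckeLevel g K) K (C5.heckeLE_heckeLevel g K))).hom.hom.hom 1) :=
    LinearMap.ext fun x => actQ_genAt ι J g K x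
  have h2 := ((baseChange_comp_apply' (actQ hHD hI hU h₃ hA V g) (genAt ι J K) w).symm.trans
    (LinearMap.congr_fun (congrArg (LinearMap.baseChange ℂ) key) w)).trans (baseChange_comp_apply' (genAt ι J _) _ w)
  have h3 : ιT hHD hI hU h₃ hA V ((actQ hHD hI hU h₃ hA V g).baseChange ℂ ((genAt ι J K).baseChange ℂ w)) =
      act hHD hI hU h₃ hA g (ιT hHD hI hU h₃ hA V ((genAt ι J K).baseChange ℂ w)) :=
    ιT_comm hHD hI hU h₃ hA g _
  exact h3.symm.trans (congrArg (ιT hHD hI hU h₃ hA V) h2)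

/-- `genC` is injective when `J^*_K` is (`ofQ` injective, `ℂ` flat over `ℚ`, `ιT` injective). [folklore] -/
theorem genC_injective (ι : L →+* ℂ) (J : letI := ι.toAlgebra; ComponentAlbanese hHD hI hU h₃ hA V h Φ C HT) (K : C5.SmallLevel C.S.K₀)
    (hinj : Function.Injective (letI := ι.toAlgebra; J.albStarQ K)) : Function.Injective (genC ι J K) := by
  have h1 : Function.Injective (genAt ι J K) := (ofQ_injective hHD hI hU h₃ hA _ _).comp hinj
  have h2 : Function.Injective ((genAt ι J K).baseChange ℂ) := by
    rw [LinearMap.baseChange_eq_ltensor]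
    exact Module.Flat.lTensor_preserves_injective_linearMap _ h1
  exact (ιT_injective hHD hI hU h₃ hA V).comp h2

/-- κ⁻¹ complexified: `(κ_K⁻¹) ⊗ ℂ : ℂ ⊗ H¹(A_K ⊗_ῑ₁ ℂ) → ℂ ⊗ H¹(A_K ⊗_ι₁ ℂ)`. [folklore] -/
abbrev kappaInvC (K : C5.SmallLevel C.S.K₀) : ACx (conjEmb ι₁) K →ₗ[ℂ] ACx ι₁ K :=
  ((bettiConjLinearEquiv ι₁ (C.A K).X 1).symm.toLinearMap).baseChange ℂ

/-- **`N_ℂ(J') := ⨆_K range (genC ῑ₁ J' K) ⊆ H`.** [cite: Liu2021, §4.2 (FJcycle.tex l. 2062–2074)] -/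
abbrev pinSpanC (J' : letI := (conjEmb ι₁).toAlgebra; ComponentAlbanese hHD hI hU h₃ hA V h Φ C HT) :
    Submodule ℂ (Tower hHD hI hU h₃ hA V) :=
  spanOfLevels (A := fun K : C5.SmallLevel C.S.K₀ => ACx (conjEmb ι₁) K) (genC (conjEmb ι₁) J')

set_option maxHeartbeats 800000 in
/-- **THE COMPLEX LIFT `E_ℂ`.**  For a record `J'` at `ῑ₁` with `J'^*_K` injective (R1-inj) and a record `J₁` at `ι₁` over the same datum: on
`N_ℂ(J')` there is a `ℂ`-linear `E : N_ℂ → H` with `E (genC ῑ₁ J' K w) = genC ι₁ J₁ K (κ_K⁻¹ ⊗ ℂ · w)`; `N_ℂ` is `act g`-stable and `E` commutes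
with every `act g`. [cite: Liu2021, §4.2 (FJcycle.tex l. 2062–2074), proof of Lemma 2.4 (1)] -/
theorem exists_towerLiftC
    (J' : letI := (conjEmb ι₁).toAlgebra; ComponentAlbanese hHD hI hU h₃ hA V h Φ C HT)
    (hinj : ∀ K : C5.SmallLevel C.S.K₀, Function.Injective (letI := (conjEmb ι₁).toAlgebra; J'.albStarQ K))
    (J₁ : letI := ι₁.toAlgebra; ComponentAlbanese hHD hI hU h₃ hA V h Φ C HT) :
    ∃ E : pinSpanC J' →ₗ[ℂ] Tower hHD hI hU h₃ hA V,
      (∀ (K : C5.SmallLevel C.S.K₀) (w : ACx (conjEmb ι₁) K) (hw : genC (conjEmb ι₁) J' K w ∈ pinSpanC J'),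
        E ⟨genC (conjEmb ι₁) J' K w, hw⟩ = genC ι₁ J₁ K (kappaInvC K w)) ∧
      ∀ g : ↥V.adelicFin,
        (∀ n, n ∈ pinSpanC J' → act hHD hI hU h₃ hA g n ∈ pinSpanC J') ∧
        ∀ (n : pinSpanC J') (hn : act hHD hI hU h₃ hA g n ∈ pinSpanC J'),
          E ⟨act hHD hI hU h₃ hA g n, hn⟩ = act hHD hI hU h₃ hA g (E n) := by
  haveI : Nonempty (C5.SmallLevel C.S.K₀) := ⟨⟨C.S.K₀, le_rfl⟩⟩
  let tr : ∀ {K' K : C5.SmallLevel C.S.K₀}, K' ≤ K → (ACx (conjEmb ι₁) K →ₗ[ℂ] ACx (conjEmb ι₁) K') :=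
    fun {K' K} hle => (letI := (conjEmb ι₁).toAlgebra; pull (Hom.baseChange ℂ (C.Atr hle.hom)).hom.hom.hom 1).baseChange ℂ
  let gen' : ∀ K : C5.SmallLevel C.S.K₀, ACx (conjEmb ι₁) K →ₗ[ℂ] Tower hHD hI hU h₃ hA V :=
    fun K => genC ι₁ J₁ K ∘ₗ kappaInvC K
  have hdir : ∀ K K' : C5.SmallLevel C.S.K₀, ∃ K₀, K₀ ≤ K ∧ K₀ ≤ K' := exists_smallLevel_le_le
  have hgen : ∀ {K' K : C5.SmallLevel C.S.K₀} (hle : K' ≤ K) (w : ACx (conjEmb ι₁) K),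
      genC (conjEmb ι₁) J' K' (tr hle w) = genC (conjEmb ι₁) J' K w :=
    fun hle w => genC_pull_Atr (conjEmb ι₁) J' hle.hom w
  have hkappa : ∀ {K' K : C5.SmallLevel C.S.K₀} (f : K' ⟶ K) (w : ACx (conjEmb ι₁) K),
      kappaInvC K' ((letI := (conjEmb ι₁).toAlgebra; pull (Hom.baseChange ℂ (C.Atr f)).hom.hom.hom 1).baseChange ℂ w) =
        ((letI := ι₁.toAlgebra; pull (Hom.baseChange ℂ (C.Atr f)).hom.hom.hom 1).baseChange ℂ) (kappaInvC K w) := by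
    intro K' K f w
    have key : (bettiConjLinearEquiv ι₁ (C.A K').X 1).symm.toLinearMap ∘ₗ
        (letI := (conjEmb ι₁).toAlgebra; pull (Hom.baseChange ℂ (C.Atr f)).hom.hom.hom 1) =
        (letI := ι₁.toAlgebra; pull (Hom.baseChange ℂ (C.Atr f)).hom.hom.hom 1) ∘ₗ
          (bettiConjLinearEquiv ι₁ (C.A K).X 1).symm.toLinearMap :=
      LinearMap.ext fun y => bettiConjLinearEquiv_symm_pull_baseChange ι₁ (C.Atr f) 1 y
    exact ((baseChange_comp_apply' _ _ w).symm.trans (LinearMap.congr_fun (congrArg (LinearMap.baseChange ℂ) key) w)).trans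
      (baseChange_comp_apply' _ _ w)
  have hgen' : ∀ {K' K : C5.SmallLevel C.S.K₀} (hle : K' ≤ K) (w : ACx (conjEmb ι₁) K), gen' K' (tr hle w) = gen' K w := by
    intro K' K hle w
    show genC ι₁ J₁ K' (kappaInvC K' ((letI := (conjEmb ι₁).toAlgebra; pull (Hom.baseChange ℂ (C.Atr hle.hom)).hom.hom.hom 1).baseChange ℂ w)) =
      genC ι₁ J₁ K (kappaInvC K w)
    rw [hkappa, genC_pull_Atr]
  have hinjg : ∀ K, Function.Injective (genC (conjEmb ι₁) J' K) := fun K => genC_injective (conjEmb ι₁) J' K (hinj K)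
  obtain ⟨E, hE⟩ := exists_lift_of_injective (A := fun K : C5.SmallLevel C.S.K₀ => ACx (conjEmb ι₁) K)
    (tr := tr) (gen := genC (conjEmb ι₁) J') (gen' := gen') hdir hgen hgen' hinjg
  refine ⟨E, fun K w hw => hE K w hw, fun g => ?_⟩
  let trg : ∀ K : C5.SmallLevel C.S.K₀, ACx (conjEmb ι₁) K →ₗ[ℂ] ACx (conjEmb ι₁) (C5.heckeLevel g K) :=
    fun K => (letI := (conjEmb ι₁).toAlgebra;
      pull (Hom.baseChange ℂ (HT.albTr g (C5.heckeLevel g K) K (C5.heckeLE_heckeLevel g K))).hom.hom.hom 1).baseChange ℂ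
  have hρ : ∀ K w, act hHD hI hU h₃ hA g (genC (conjEmb ι₁) J' K w) = genC (conjEmb ι₁) J' (C5.heckeLevel g K) (trg K w) :=
    fun K w => act_genC (conjEmb ι₁) J' g K w
  have hkappa' : ∀ (K : C5.SmallLevel C.S.K₀) (w : ACx (conjEmb ι₁) K),
      kappaInvC (C5.heckeLevel g K) (trg K w) =
        ((letI := ι₁.toAlgebra;
          pull (Hom.baseChange ℂ (HT.albTr g (C5.heckeLevel g K) K (C5.heckeLE_heckeLevel g K))).hom.hom.hom 1).baseChange ℂ)
          (kappaInvC K w) := by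
    intro K w
    have key : (bettiConjLinearEquiv ι₁ (C.A (C5.heckeLevel g K)).X 1).symm.toLinearMap ∘ₗ
        (letI := (conjEmb ι₁).toAlgebra;
          pull (Hom.baseChange ℂ (HT.albTr g (C5.heckeLevel g K) K (C5.heckeLE_heckeLevel g K))).hom.hom.hom 1) =
        (letI := ι₁.toAlgebra;
          pull (Hom.baseChange ℂ (HT.albTr g (C5.heckeLevel g K) K (C5.heckeLE_heckeLevel g K))).hom.hom.hom 1) ∘ₗ
          (bettiConjLinearEquiv ι₁ (C.A K).X 1).symm.toLinearMap :=
      LinearMap.ext fun y => bettiConjLinearEquiv_symm_pull_baseChange ι₁ _ 1 y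
    exact ((baseChange_comp_apply' _ _ w).symm.trans (LinearMap.congr_fun (congrArg (LinearMap.baseChange ℂ) key) w)).trans
      (baseChange_comp_apply' _ _ w)
  have hρ' : ∀ K w, act hHD hI hU h₃ hA g (gen' K w) = gen' (C5.heckeLevel g K) (trg K w) := by
    intro K w
    show act hHD hI hU h₃ hA g (genC ι₁ J₁ K (kappaInvC K w)) = genC ι₁ J₁ (C5.heckeLevel g K) (kappaInvC (C5.heckeLevel g K) (trg K w))
    rw [act_genC, hkappa']
  exact lift_equivariant (A := fun K : C5.SmallLevel C.S.K₀ => ACx (conjEmb ι₁) K) (tr := tr)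
    (gen := genC (conjEmb ι₁) J') (gen' := gen') hdir hgen (act hHD hI hU h₃ hA g) (fun K => C5.heckeLevel g K) trg hρ hρ' E hE

end Complex

end Summit.HodgeConjecture.CorCM.D2Bridge.NotHJ

end
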